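import Summits.AnomalousDissipation.AnomalousDissipation.Cruxes.BurgersLayerKH.SketchIdeator2
import Literature.Analysis.OperatorTheory.PseudoResolvent
import Literature.Analysis.OperatorTheory.RieszIntegralStrongLimit
import Literature.Analysis.OperatorTheory.RieszProjectionContour
import Literature.Analysis.OperatorTheory.CompactPerturbationSpectrum

/-!
# Line `gaussian-splitting-persistence` — skeleton for crux `BurgersLayerKH` (stmt-AnomalousDissipation-3008)

Crux (route `MarginalStabilityChain`, rank 3), FIXED: `∃ Re₂ c₀ > 0, ∀ Re ≥ Re₂` an unstable
Gaussian-class eigenmode `(α, σ, ψ)` of the linearised strained viscous Burgers layer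
`σω = −iαRe(Uω + U''ψ) + ω + yω' + ω'' − α²ω`, `ω = −(ψ'' − α²ψ)`, `U = ∫₀ʸe^{−s²/2}`, with
`re σ ≥ c₀·Re`.

## The line (idea card `Ideas/gaussian-splitting-persistence.md`, triage TRIAGE-r1-1/2: pass, pass)

Divide the equation by `Re` and put `ε := 1/Re`, `λ := σ/Re`:  `λω = Mω + Kω + εAω` with
`Mω = −iαU·ω` (bounded, skew-adjoint), `Kω = −iαU''·(G_α ∗ ω)` (Tollmien coupling through the
Green operator `G_α = (α² − ∂²)⁻¹`, COMPACT), `Aω = ω'' + yω' + ω − α²ω` (Ornstein–Uhlenbeck +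
stretching, self-adjoint and `≤ −α²` in the Gallay–Wayne Gaussian space `X = L²(e^{y²/2}dy)`).
We work in WEBER COORDINATES `h = e^{y²/4}ω`, the unitary image of `X` onto the flat
`L²(ℝ) = Lp ℂ 2 volume` (the same conjugation as the disprover's `W = e^{y²/4}ω`,
`Disproof.weber_complex`): there `A` becomes `A_W h = h'' − (y²/4)h + (1/2 − α²)h`
(harmonic oscillator, ground energy `1/2`), `M` is unchanged and `K` is the integral operator with
the Gaussian (Hilbert–Schmidt) kernel `tollmienKernel α y s = e^{y²/4}(−iαU''(y))·e^{−α|y−s|}/(2α)·e^{−s²/4}`.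
For `re z > 0` the "free" strained resolvent `J ε z = (z − M − εA_W)⁻¹` is a pseudo-resolvent with
the Lumer–Phillips bound `‖J ε z‖ ≤ 1/re z` UNIFORMLY in `ε > 0`, and `J ε z → (z − M)⁻¹` STRONGLY as
`ε → 0⁺`; compactness of `K` upgrades this to norm convergence of `J ε z ∘ K`, so the Riesz
integral of `z ↦ (1 − J ε z K)⁻¹ J ε z` around the Rayleigh eigenvalue `λ₀ = −iαc`
(`re λ₀ = α·im c > 0`) of the bounded operator `M + K` stays non-zero for small `ε`
(Kato VIII §1.4 stable eigenvalue / Albritton–Brué–Colombo closing step, tree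
`RieszIntegralStrongLimit`), whence a fixed vector `J ε z (K u) = u`, `u ≠ 0`, `|z − λ₀| < r`:
an eigenvalue `z` of `M + K + εA_W`; undoing the scaling `σ = Re·z`, `re σ ≥ (α im c − r)·Re`.

## Stubs (7) and composition

* `stub_rayleighMode` — INPUT (cards B/C of the crux: odd-evans-ivt / pt-standing-mode-continuation /
  vortex-sheet-*): one unstable Rayleigh mode of the erf layer (`RayleighUnstableErf`, SketchIdeator2).
* `stub_gaussianSplitting` — CONSTRUCTION of `M`, `K`, `J` on `L²` with the dictionary
  `IsGaussianSplitting` (how they act on functions) + `{re z > 0} ⊂ ρ(M)`, `‖(z − M)⁻¹‖ ≤ 1/re z`,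
  `J ε` an `IsPseudoResolvent` on `{re z > 0}` with `‖J ε z‖ ≤ 1/re z`.  (hardest)
* `stub_tollmienCompact` — `K` is compact (Hilbert–Schmidt Gaussian kernel).
* `stub_inviscidStrongLimit` — `J ε z f → (z − M)⁻¹ f` as `ε → 0⁺` (Kato VIII §1, two-line core +
  density).
* `stub_stableEigenvalue` — ABSTRACT (any complex Hilbert space): bounded `M` with half-plane
  resolvent bound, compact `K`, eigenpair `(λ₀, u₀)` of `M + K` with `re λ₀ > 0`, pseudo-resolvents
  `J ε` with the uniform bound converging strongly to `(z − M)⁻¹` ⟹ for every `r > 0`, for all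
  small `ε > 0` a fixed vector `J ε z (K u) = u ≠ 0` with `|z − λ₀| < r`.
* `stub_rayleighEigenvector` — dictionary IN: a Rayleigh mode `(α, c, φ)` gives
  `u₀ = [e^{y²/4}·(−(φ'' − α²φ))] ≠ 0` with `(M + K)u₀ = (−iαc)u₀` (Green inversion `G_α ∗ ω₀ = φ`).
* `stub_classicalMode` — dictionary OUT: a fixed vector `J Re⁻¹ z (K u) = u ≠ 0`, `re z > 0`, is a
  classical Gaussian-class strained mode `IsStrainedMode Re α (Re·z) ψ`, `ψ = G_α ∗ (e^{−y²/4}h)`.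
* `persistenceQuant_of : PersistenceQuant` — from stubs 2–7 alone: the A-lever's OUTPUT in the shared
  interface of SketchIdeator2 (`‖σ/Re + iαc‖ < ρ` at the same `α`, `Re₂ := 2/ε₀`), i.e. exactly the
  `stub_persistence` consumed by the sibling lines `pt_standing_mode_continuation` / `vortex_sheet_unfolding`.
* `BurgersLayerKH_of : BurgersLayerKH` — the skeleton theorem (no hypotheses; no `sorry` of its own):
  `stub_rayleighMode` + `persistenceQuant_of` at `ρ := α·im c/2`, `c₀ := α·im c/2`.

## Disproof used (Cruxes/BurgersLayerKH/Disproof.lean, cdisprove v4b)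

* `burgersLayerKH_false_without_coupling` (any proof must use the `U''ψ` coupling): honoured — the
  eigenvalue comes from `K` (`stub_rayleighEigenvector`, `stub_stableEigenvalue`); with `K = 0` the
  fixed-point equation `J ε z 0 = u` has no solution `u ≠ 0`.
* `burgersLayerKH_false_forall_Re` (threshold `Re₂` load-bearing): honoured — `Re₂ = 2/ε₀` from the
  `ε`-smallness of `stub_stableEigenvalue`.
* `not_burgersLayerKHWithRate_of_gt` (no rate above `√(π/2)`): honoured — `c₀ = α im c/2 ≤ 0.1`.
* `burgersLayerKH_false_real_mode` (ψ genuinely complex): honoured — nothing real is claimed; the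
  mode is the complex Rayleigh eigenfunction's continuation.
* `weber_complex` / `weber_energy` (bounded C² solutions of the Weber equation vanish): the
  uniqueness engine the prover of `stub_gaussianSplitting`/`stub_inviscidStrongLimit` reuses.
No `Theorems/BurgersLayerKH/Negative/` lemma exists (2026-08-16); `ledger negatives` (5 items) —
none concerns linear stability.
-/

set_option linter.dupNamespace false

noncomputable section

open Filter Topology MeasureTheory
open Literature.Analysis.OperatorTheory (IsPseudoResolvent)

namespace Summit.AnomalousDissipation.AnomalousDissipation.Cruxes.BurgersLayerKH.GaussianSplittingPersistence

open Summit.AnomalousDissipation.AnomalousDissipation.Theses.MarginalStabilityChain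

/-- The Hilbert space of the line: flat `L²(ℝ; ℂ)` in Weber coordinates `h = e^{y²/4}ω`
(unitarily `X = L²(e^{y²/2}dy)` of Gallay–Wayne). -/
local notation "L2" => Lp ℂ 2 (volume : Measure ℝ)

/-- The Tollmien coupling kernel in Weber coordinates:
`k(y, s) = e^{y²/4} · (−iα U''(y)) · e^{−α|y−s|}/(2α) · e^{−s²/4}`, i.e. `K h = e^{y²/4}(−iαU''·(G_α ∗ ω))`
with `ω = e^{−s²/4}h`; `|k(y,s)| = (|y|/2) e^{−y²/4 − α|y−s| − s²/4}` is Gaussian in both variables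
(Hilbert–Schmidt). -/
def tollmienKernel (α : ℝ) (y s : ℝ) : ℂ :=
  -(Complex.I * α) * (erfU'' y : ℂ) * (Real.exp (y ^ 2 / 4) : ℂ) *
    ((Real.exp (-(α * |y - s|)) / (2 * α) : ℝ) : ℂ) * (Real.exp (-(s ^ 2) / 4) : ℂ)

/-- **The Gaussian splitting of the strained-layer operator, as a dictionary.** At wavenumber
`α > 0`, bounded operators `M`, `K` on `L²(ℝ)` and a family `J ε z` (`ε > 0`, `re z > 0`) such that
* `M` is multiplication by `−iαU(y)` and `{re z > 0} ⊆ ρ(M)` with `‖(z − M)⁻¹‖ ≤ 1/re z`;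
* `K` is the Tollmien integral operator with kernel `tollmienKernel α`;
* `J ε` is a pseudo-resolvent on `{re z > 0}` with the Lumer–Phillips bound `‖J ε z‖ ≤ 1/re z`,
  and `J ε z f` IS the bounded classical solution `h` of the Weber-form resolvent equation
  `ε(h'' − (y²/4)h + (1/2 − α²)h) − iαU h = z h − g` whenever `f` has a continuous representative `g`
  (so `J ε z = (z − M − εA_W)⁻¹`, the resolvent of the m-sectorial strained Ornstein–Uhlenbeck
  operator; uniqueness of bounded `C²` solutions is `Disproof.weber_complex`).
Nothing is asserted here: existence is `stub_gaussianSplitting`. -/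
structure IsGaussianSplitting (α : ℝ) (M K : L2 →L[ℂ] L2) (J : ℝ → ℂ → L2 →L[ℂ] L2) : Prop where
  pos : 0 < α
  M_apply : ∀ h : L2, ((M h : L2) : ℝ → ℂ) =ᵐ[volume] fun y => -(Complex.I * α * (erfU y : ℂ)) * h y
  M_res : ∀ z : ℂ, 0 < z.re → z ∈ resolventSet ℂ M ∧ ‖resolvent M z‖ ≤ z.re⁻¹
  K_apply : ∀ h : L2, ((K h : L2) : ℝ → ℂ) =ᵐ[volume] fun y => ∫ s, tollmienKernel α y s * h s
  J_pseudo : ∀ ε : ℝ, 0 < ε → IsPseudoResolvent {z : ℂ | 0 < z.re} (J ε)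
  J_bound : ∀ ε : ℝ, 0 < ε → ∀ z : ℂ, 0 < z.re → ‖J ε z‖ ≤ z.re⁻¹
  J_apply : ∀ ε : ℝ, 0 < ε → ∀ z : ℂ, 0 < z.re → ∀ (f : L2) (g : ℝ → ℂ), Continuous g →
    ((f : ℝ → ℂ) =ᵐ[volume] g) →
      ∃ h : ℝ → ℂ, ContDiff ℝ 2 h ∧ (((J ε z f : L2) : ℝ → ℂ) =ᵐ[volume] h) ∧
        (∃ C : ℝ, ∀ y, ‖h y‖ ≤ C) ∧
        ∀ y : ℝ, (ε : ℂ) * (iteratedDeriv 2 h y - ((y : ℂ) ^ 2 / 4) * h y + (1 / 2 - (α : ℂ) ^ 2) * h y)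
          - Complex.I * α * (erfU y : ℂ) * h y = z * h y - g y

/-! ## Registered stubs -/

/-- **stub_rayleighMode — the inviscid input (Transfer `C⁺` of the card).** The erf layer
`U = ∫₀ʸe^{−s²/2}` has an unstable Rayleigh mode: `∃ α > 0, c (im c > 0), φ ∈ C², φ ≢ 0, φ → 0 at
±∞` with `(U − c)(φ'' − α²φ) − U''φ = 0`. Supplied by the sibling lines of this crux (odd-evans-ivt:
real Evans function + IVT on the imaginary `c`-axis just below the neutral wavenumber
`α_s = 0.733`; vortex-sheet-unfolding/continuation: simple-zero persistence from the sheet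
eigenvalue `c₀ = i√(π/2)` as `α → 0⁺`; pt-standing-mode-continuation), or Lin 2003 (class `K⁺`).
Numerics (j004866, j004789, j004783, two triage codes): `αc_i = 0.1915` at `α = 0.34`, standing.
Size L (but shared; in-tree tools `exists_boundState_of_rayleigh`, `HalfLineShooting`, `JostDecay`).
[source: Lin2003 = doi:10.1137/s0036141002406266; BeronovKida1995 = zbl:0938.76538 §III] -/
theorem stub_rayleighMode : RayleighUnstableErf := by
  sorry

/-- **stub_gaussianSplitting — construction of the splitting (hardest stub).** For every `α > 0`
there are `M`, `K`, `J` with `IsGaussianSplitting α M K J`: `M` = multiplication by the bounded real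
function `−iαU` (normal; `(z − M)⁻¹` = multiplication by `(z + iαU)⁻¹`, `|z + iαU| ≥ re z`); `K` =
the `L²`-kernel operator of `tollmienKernel α` (kernel in `L²(ℝ²)`, cf.
`Literature.Analysis.OperatorTheory.memLp_two_integral_kernel_mul`); `J ε z` = the resolvent of the
m-sectorial operator `M + εA_W`, `A_W = ∂² − y²/4 + 1/2 − α² ≤ −α²` (Lax–Milgram on the form domain
`{h ∈ H¹, yh ∈ L²}` with `re⟨(z − M − εA_W)h, h⟩ ≥ (re z + εα²)‖h‖²`, or the ODE Green's function
from the two Weber/parabolic-cylinder recessive solutions, `Literature.Analysis.ODE.RecessiveSolution`),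
plus 1-D elliptic regularity (`H²_loc` + continuous data ⇒ `C²`; form domain ⊂ `H¹ ⊂ C_b`) for
`J_apply`, the resolvent identity on `{re z > 0}` and the numerical-range bound `‖J ε z‖ ≤ 1/re z`
(the OU Dirichlet form in the weight `e^{y²/2}` = `Disproof.re_le_of_noCoupling`'s identity).
Why plausibly true: textbook (Kato VI §2 m-sectorial forms; Gallay–Wayne 2002 for the OU part).
Size L. [source: Kato1966 VI-§2.1 Thm 2.1, VIII-§1.1; GallayWayne2002 = doi:10.1007/s002050200200 App. A] -/
theorem stub_gaussianSplitting :
    ∀ α : ℝ, 0 < α →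
      ∃ (M K : L2 →L[ℂ] L2) (J : ℝ → ℂ → L2 →L[ℂ] L2), IsGaussianSplitting α M K J := by
  sorry

/-- **stub_tollmienCompact — the Tollmien coupling is compact.** Any bounded operator acting as
the integral operator with kernel `tollmienKernel α` (continuous, `|k| ≤ (|y|/2)e^{−y²/4−s²/4}`,
hence `k ∈ L²(ℝ²)`) is Hilbert–Schmidt, hence compact (finite-rank truncations in an ONB converge in
norm; Mathlib `isCompactOperator_of_tendsto`, tree `hasSum_norm_sq_integral_kernel_mul`). This is
fact (iii) of the card: `U'' ∈ X` is what makes `K` compact. Size M. [source: ReedSimonI1980 Thm VI.22(e), Thm VI.23] -/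
theorem stub_tollmienCompact :
    ∀ {α : ℝ} {M K : L2 →L[ℂ] L2} {J : ℝ → ℂ → L2 →L[ℂ] L2},
      IsGaussianSplitting α M K J → IsCompactOperator K := by
  sorry

/-- **stub_inviscidStrongLimit — strong convergence of the free strained resolvent (Kato VIII §1).**
For `re z > 0` and every `f ∈ L²`, `J ε z f → (z − M)⁻¹ f` as `ε → 0⁺`. Core (two lines): for
`g ∈ C_c^∞` and `f := (z − M)g = (z + iαU)g` one has `J ε z f − g = ε·J ε z (A_W g)` (left-inverse
property from `J_apply` + uniqueness `Disproof.weber_complex`), of norm `≤ ε‖A_W g‖/re z → 0`; such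
`f` exhaust `C_c^∞` (divide by the non-vanishing smooth `z + iαU`), dense in `L²`
(`MeasureTheory.MemLp.exists_hasCompactSupport_...`/`ContDiff` bump density), and
`‖J ε z − (z − M)⁻¹‖ ≤ 2/re z` gives the rest (ε/3). Size M.
[source: Kato1966 VIII-§1.1–1.2 (strong resolvent convergence, Thm 1.5); ShvydkoyFriedlander2005 = arXiv:math/0509538 Lemma 4.1] -/
theorem stub_inviscidStrongLimit :
    ∀ {α : ℝ} {M K : L2 →L[ℂ] L2} {J : ℝ → ℂ → L2 →L[ℂ] L2},
      IsGaussianSplitting α M K J →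
        ∀ z : ℂ, 0 < z.re → ∀ f : L2,
          Tendsto (fun ε : ℝ => J ε z f) (𝓝[>] 0) (𝓝 (resolvent M z f)) := by
  sorry

/-- **stub_stableEigenvalue — the abstract persistence theorem (Kato's stable eigenvalue under
"skew-bounded + compact + ε·dissipative", pseudo-resolvent form).** Let `H` be a complex Hilbert
space, `M` bounded with `{re z > 0} ⊆ ρ(M)`, `‖(z − M)⁻¹‖ ≤ 1/re z`; `K` compact; `(M + K)u₀ = λ₀u₀`,
`u₀ ≠ 0`, `re λ₀ > 0`; `J ε` (`ε > 0`) pseudo-resolvents on `{re z > 0}` with `‖J ε z‖ ≤ 1/re z` and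
`J ε z f → (z − M)⁻¹ f` (`ε → 0⁺`). Then for every `r > 0` there is `ε₀ > 0` such that every
`ε ∈ (0, ε₀)` has `z`, `|z − λ₀| < r`, and `u ≠ 0` with `J ε z (K u) = u` (an eigenvector of
`M + K + (J ε)⁻¹`-operator with eigenvalue `z`). Proof sketch (all tools in tree):
(1) `spectrum_add_compact_isolated_eigenvalues_halfPlane` (good point `re z > ‖K‖`): `λ₀` is an
isolated point of `σ(M + K)`; pick `ρ ≤ min(r/2, r₀)`, circle `S = sphere λ₀ ρ ⊂ ρ(M + K) ∩ {re z > 0}`.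
(2) `z − (M+K) = (z − M)(1 − R_M(z)K)` (`algebraMap_sub_add_eq_mul`), so `(1 − R_M K)⁻¹` is bounded
on `S` by `C₁`. (3) strong × compact ⇒ `sup_S ‖J ε z K − R_M(z)K‖ → 0` (uniform bound `2/δ`,
`δ = re λ₀ − ρ`; compact image of the unit ball; equi-Lipschitz in `z` from the pseudo-resolvent
identity: `‖J ε z − J ε w‖ ≤ |z − w|/δ²`; finite net on `S`). (4) Neumann: `(1 − J ε z K)⁻¹ →
(1 − R_M K)⁻¹` in norm on `S`; hence `F_ε(z) := (1 − J ε z K)⁻¹ J ε z → resolvent (M+K) z` STRONGLY,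
uniformly on `S`. (5) `circleIntegral_resolvent_ne_zero_of_apply_eq_smul` (`u₀` inside) +
`eventually_circleIntegral_ne_zero_of_strong'` (filter `𝓝[>] 0`, countably generated): `∮_S F_ε ≠ 0`
for small `ε`. (6) If `1 − J ε z K` were invertible on the closed disc, `F_ε` would be holomorphic
on a neighbourhood of it (`IsPseudoResolvent.differentiableOn`, `differentiableAt_inverse`) and
`∮_S F_ε = 0` (Cauchy) — contradiction; at the bad `z`, `J ε z K` is compact, so the Fredholm
alternative `isUnit_one_sub_or_exists_fixed_of_isCompactOperator` gives `u`. Size M–L, pure operator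
theory. [source: Kato1966 VIII-§1.4 (stable eigenvalues (1.29)–(1.31)), IV-§3.5 Thm 3.16;
AlbrittonBrueColombo2022AnnMath = arXiv:2112.03116 §2.4 (proof of Prop. 2.6); ShvydkoyFriedlander2005 Thm 2.1] -/
theorem stub_stableEigenvalue :
    ∀ (H : Type) [NormedAddCommGroup H] [InnerProductSpace ℂ H] [CompleteSpace H]
      (M K : H →L[ℂ] H) (J : ℝ → ℂ → H →L[ℂ] H) (lam : ℂ) (u₀ : H),
      (∀ z : ℂ, 0 < z.re → z ∈ resolventSet ℂ M ∧ ‖resolvent M z‖ ≤ z.re⁻¹) →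
      IsCompactOperator K →
      0 < lam.re → u₀ ≠ 0 → (M + K) u₀ = lam • u₀ →
      (∀ ε : ℝ, 0 < ε → IsPseudoResolvent {z : ℂ | 0 < z.re} (J ε)) →
      (∀ ε : ℝ, 0 < ε → ∀ z : ℂ, 0 < z.re → ‖J ε z‖ ≤ z.re⁻¹) →
      (∀ z : ℂ, 0 < z.re → ∀ f : H, Tendsto (fun ε : ℝ => J ε z f) (𝓝[>] 0) (𝓝 (resolvent M z f))) →
      ∀ r : ℝ, 0 < r → ∃ ε₀ : ℝ, 0 < ε₀ ∧ ∀ ε : ℝ, 0 < ε → ε < ε₀ →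
        ∃ z : ℂ, dist z lam < r ∧ ∃ u : H, u ≠ 0 ∧ J ε z (K u) = u := by
  sorry

/-- **stub_rayleighEigenvector — dictionary IN: a Rayleigh mode is an eigenvector of `M + K`.**
If `(α, c, φ)` is a Rayleigh mode of the erf layer then `ω₀ := −(φ'' − α²φ) = −U''φ/(U − c)` is
continuous with `|ω₀| ≤ (‖φ‖_∞/im c)|y|e^{−y²/2}`, so `h₀ := e^{y²/4}ω₀ ∈ L²`, `h₀ ≢ 0` (else
`φ'' = α²φ`, `φ → 0` forces `φ ≡ 0`: `eq_zero_of_bounded_solution`), and `G_α ∗ ω₀ = φ` (bounded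
solutions of `g'' = α²g − ω₀` are the Green potential: tree
`Theorems.MarginalStabilityChainBurgersLayerLowRe.eq_green_of_bounded`); hence a.e.
`(M + K)[h₀] = e^{y²/4}(−iα)(Uω₀ + U''φ) = e^{y²/4}(−iα)·c·ω₀ = (−iαc)·h₀` (Rayleigh's equation says
`U''φ = −(U − c)ω₀`). Fact (iv) of the card: the unstable Rayleigh eigenfunction automatically lives
in `X`. Size M. [source: Drazin2002 §8 (Rayleigh's equation); card gaussian-splitting-persistence (iv)] -/
theorem stub_rayleighEigenvector :
    ∀ {α : ℝ} {M K : L2 →L[ℂ] L2} {J : ℝ → ℂ → L2 →L[ℂ] L2} {c : ℂ} {φ : ℝ → ℂ},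
      IsGaussianSplitting α M K J → IsRayleighMode α c φ →
        ∃ u₀ : L2, u₀ ≠ 0 ∧ (M + K) u₀ = (-(Complex.I * α * c)) • u₀ := by
  sorry

/-- **stub_classicalMode — dictionary OUT: fixed vectors are classical Gaussian-class modes.**
If `u ≠ 0` in `L²`, `Re > 0`, `re z > 0` and `J Re⁻¹ z (K u) = u`, then with `g := ∫ k(·,s)u(s)ds`
(continuous, Gaussian-bounded: `K_apply`) `J_apply` gives a bounded `C²` representative `h` of `u`
solving `Re⁻¹·A_W h − iαU h = z h − g` pointwise; put `ω := e^{−y²/4}h` (so `|ω| ≤ Ce^{−y²/4}`) and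
`ψ := G_α ∗ ω = (2α)⁻¹∫e^{−α|y−s|}ω(s)ds` (`green_hasDerivAt`: `ψ'' = α²ψ − ω`, so
`ω = −(ψ'' − α²ψ)`, `ψ ∈ C⁴`, `ψ → 0` at `±∞` by `green_norm_le_integral`-type tails, `ψ ≢ 0` since
`ω ≢ 0`), and `g = e^{y²/4}(−iαU''ψ)`; undoing the Weber conjugation
(`e^{y²/4}(ω'' + yω' + ω − α²ω) = A_W h`) and multiplying by `Re` gives verbatim the crux ODE with
`σ = Re·z`: `IsStrainedMode Re α (Re·z) ψ`. Size M (calculus bookkeeping of the kind in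
`Theorems.MarginalStabilityChainBurgersLayerLowRePrep`). [source: card gaussian-splitting-persistence; BeronovKida1995 §III.B eq. (2.7)–(2.9)] -/
theorem stub_classicalMode :
    ∀ {α : ℝ} {M K : L2 →L[ℂ] L2} {J : ℝ → ℂ → L2 →L[ℂ] L2} {Re : ℝ} {z : ℂ} {u : L2},
      IsGaussianSplitting α M K J → 0 < Re → 0 < z.re → u ≠ 0 → J Re⁻¹ z (K u) = u →
        ∃ ψ : ℝ → ℂ, IsStrainedMode Re α ((Re : ℂ) * z) ψ := by
  sorry

/-! ## Composition (kernel-checked; no `sorry` outside the seven stubs) -/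

/-- **The A-lever delivers the shared interface `PersistenceQuant`** (SketchIdeator2; consumed as
`stub_persistence` by the sibling lines `pt_standing_mode_continuation` and `vortex_sheet_unfolding`): for
every Rayleigh mode `(α, c, φ)` and every `ρ > 0` there is `Re₂ > 0` such that each `Re ≥ Re₂` carries a
Gaussian-class strained mode AT THE SAME WAVENUMBER with `‖σ/Re + iαc‖ < ρ`. From stubs 2–7 only:
splitting ↦ eigenvector `u₀` (`λ₀ = −iαc`, `re λ₀ = α·im c`) ↦ `stub_stableEigenvalue` at radius
`min ρ (re λ₀/2)` ↦ fixed vector ↦ `stub_classicalMode`, `σ := Re·z`, `Re₂ := 2/ε₀`. -/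
theorem persistenceQuant_of : PersistenceQuant := by
  intro α c φ hR ρ hρ
  have hα : 0 < α := hR.1
  have hc : 0 < c.im := hR.2.1
  -- the Gaussian splitting `M`, `K`, `J ε z` on `L²` at this wavenumber
  obtain ⟨M, K, J, hS⟩ := stub_gaussianSplitting α hα
  -- dictionary IN: the Rayleigh mode is an eigenvector of `M + K`, eigenvalue `λ₀ = −iαc`
  obtain ⟨u₀, hu₀, heig⟩ := stub_rayleighEigenvector hS hR
  set lam : ℂ := -(Complex.I * α * c) with hlam
  have hlam_re : lam.re = α * c.im := by
    simp [hlam, Complex.mul_re, Complex.mul_im]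
  have hlam_pos : 0 < lam.re := by rw [hlam_re]; positivity
  -- abstract persistence (compact `K`, strong limit of `J ε z`) at radius `min ρ (re λ₀ / 2)`
  have hr : 0 < min ρ (lam.re / 2) := lt_min hρ (by positivity)
  obtain ⟨ε₀, hε₀, hP⟩ := stub_stableEigenvalue (Lp ℂ 2 (volume : Measure ℝ)) M K J lam u₀
    hS.M_res (stub_tollmienCompact hS) hlam_pos hu₀ heig hS.J_pseudo hS.J_bound
    (stub_inviscidStrongLimit hS) (min ρ (lam.re / 2)) hr
  refine ⟨2 / ε₀, by positivity, fun Re hRe => ?_⟩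
  have hRe0 : 0 < Re := lt_of_lt_of_le (by positivity) hRe
  have hε1 : 0 < Re⁻¹ := inv_pos.2 hRe0
  have hε2 : Re⁻¹ < ε₀ := by
    rw [inv_lt_comm₀ hRe0 hε₀]
    have h2ε : ε₀⁻¹ < 2 / ε₀ := by
      rw [div_eq_mul_inv]
      linarith [inv_pos.2 hε₀]
    exact lt_of_lt_of_le h2ε hRe
  obtain ⟨z, hz, u, hu, hfix⟩ := hP Re⁻¹ hε1 hε2
  have hzρ : dist z lam < ρ := lt_of_lt_of_le hz (min_le_left _ _)
  have hz2 : dist z lam < lam.re / 2 := lt_of_lt_of_le hz (min_le_right _ _)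
  have hzre : lam.re / 2 < z.re := by
    have hle : |(z - lam).re| ≤ ‖z - lam‖ := Complex.abs_re_le_norm (z - lam)
    have hlt : ‖z - lam‖ < lam.re / 2 := by rwa [← dist_eq_norm]
    have hsub : (z - lam).re = z.re - lam.re := Complex.sub_re z lam
    rw [hsub] at hle
    have := (abs_lt.1 (lt_of_le_of_lt hle hlt)).1
    linarith
  have hz0 : 0 < z.re := lt_trans (by positivity) hzre
  -- dictionary OUT: the fixed vector is a classical Gaussian-class mode with `σ = Re·z`
  obtain ⟨ψ, hmode⟩ := stub_classicalMode hS hRe0 hz0 hu hfix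
  refine ⟨(Re : ℂ) * z, ψ, hmode, ?_⟩
  have hRe0' : (Re : ℂ) ≠ 0 := by exact_mod_cast hRe0.ne'
  have hquot : (Re : ℂ) * z / (Re : ℂ) = z := by
    field_simp
  have hshift : z + Complex.I * (α : ℂ) * c = z - lam := by
    rw [hlam]; ring
  rw [hquot, hshift, ← dist_eq_norm]
  exact hzρ

/-- **The line concludes the crux** — `BurgersLayerKH` from exactly the seven registered stubs
(`stub_rayleighMode` and, through `persistenceQuant_of`, `stub_gaussianSplitting`, `stub_tollmienCompact`,
`stub_inviscidStrongLimit`, `stub_stableEigenvalue`, `stub_rayleighEigenvector`, `stub_classicalMode`) and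
Mathlib logic: `c₀ := α·im c/2`, `Re₂` from `persistenceQuant_of` at `ρ := α·im c/2`, and
`‖σ/Re + iαc‖ < α·im c/2 ⇒ re σ ≥ (α·im c/2)·Re`. This is the skeleton theorem audited by
`#h21_check_skeleton` (conclusion = the route decl BY NAME, no hypotheses; it becomes the crux proof verbatim
once the stubs are proved). -/
theorem BurgersLayerKH_of : BurgersLayerKH := by
  -- the inviscid input: an unstable Rayleigh mode `(α, c, φ)` of the erf layer
  obtain ⟨α, c, φ, hR⟩ := stub_rayleighMode
  have hα : 0 < α := hR.1
  have hc : 0 < c.im := hR.2.1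
  obtain ⟨Re₂, hRe₂, hP⟩ := persistenceQuant_of α c φ hR (α * c.im / 2) (by positivity)
  refine ⟨Re₂, α * c.im / 2, by positivity, fun Re hRe => ?_⟩
  have hRe0 : 0 < Re := lt_of_lt_of_le hRe₂ hRe
  obtain ⟨σ, ψ, hmode, hnear⟩ := hP Re hRe
  obtain ⟨hα', hψ4, hne, htop, hbot, hC, hode⟩ := hmode
  have hσ : α * c.im / 2 * Re ≤ σ.re := by
    have hle : |(σ / (Re : ℂ) + Complex.I * (α : ℂ) * c).re| ≤ ‖σ / (Re : ℂ) + Complex.I * (α : ℂ) * c‖ :=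
      Complex.abs_re_le_norm _
    have hre : (σ / (Re : ℂ) + Complex.I * (α : ℂ) * c).re = σ.re / Re - α * c.im := by
      simp [Complex.add_re, Complex.div_ofReal_re, Complex.mul_re, Complex.mul_im]; ring
    rw [hre] at hle
    have h1 := (abs_lt.1 (lt_of_le_of_lt hle hnear)).1
    have h2 : α * c.im / 2 < σ.re / Re := by linarith
    rw [lt_div_iff₀ hRe0] at h2
    linarith
  exact ⟨α, σ, ψ, hα', hσ, hψ4, hne, htop, hbot, hC, hode⟩

end Summit.AnomalousDissipation.AnomalousDissipation.Cruxes.BurgersLayerKH.GaussianSplittingPersistence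

end
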